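import Literature.NumberTheory.LFunctions.ExceptionalCharacters
import Literature.NumberTheory.LFunctions.ExceptionalCharacterPrimesInProgressions
import Literature.NumberTheory.LFunctions.ExceptionalCharacterTwinPrimes
import Literature.NumberTheory.LFunctions.NoExceptionalZeroUpToTenPowTen
import Literature.NumberTheory.LFunctions.RealCharacterLadderLeaves
import HarnessLib
import Summits.Parity.GeneralizedHardyLittlewood.Theorems.UnboundedSiegelZeros

/-!
# The illusory-world hypotheses have no witness of small conductor: Siegel zeros of any quality,
# and exceptional characters of any strength, are excluded on the range of a certified table

Topic `Literature/NumberTheory/LFunctions` (namespace `Literature.NumberTheory.LFunctions`).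
PROVED BOOKKEEPING for the cell `parity-realchar` (SIEGEL INSTRUMENT, deliverable (3): "the
contrapositive links to the certified leaves"). No new mathematics and no new named fact: this file
connects the two criteria of the column REALCHAR — WIDE `NoRealZeroUpTo Q` (rung leaves
`NoRealZeroUpTo_1e9`, `_1e8`, `_4e5`) and NARROW `NoExceptionalZeroUpTo Q c₀`
(`luZamanZhao2026_theorem11 ⇒ NoExceptionalZeroUpTo 10¹⁰ (1/5)`) — with the ANTECEDENTS of the
illusory-world theorems already in the tree:

* Tao–Teräväinen's Siegel zeros of quality `η ≥ 10`, `Literature.Barriers.Parity.IsSiegelZero χ η`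
  (`χ` primitive quadratic mod `q`, `L(1 − 1/(η log q), χ) = 0`), the atoms of the registered open
  hypothesis `Literature.Barriers.Parity.UnboundedSiegelZeros` behind Heath-Brown's dichotomy
  `Literature.Barriers.Parity.SiegelZeroTwinPrimes`;
* Merikoski's exceptional characters of strength `A`, `ExceptionalCharactersOfStrength A`
  (`‖L(1,χ)‖ ≤ (log q)^{−A}` at arbitrarily large conductors), and Friedlander–Iwaniec's
  `η(D) = L(1,χ) log D`.

What is proved (all elementary):
* `IsSiegelZero.quality_lt_inv_of_noExceptionalZeroUpTo` — on a narrow table of width `c₀` every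
  Siegel zero attached to a conductor `3 ≤ q ≤ Q` has quality `η < 1/c₀`; hence
  (`not_isSiegelZero_of_noExceptionalZeroUpTo`) no Siegel zero AT ALL (quality `≥ 10`) at such
  conductors once `c₀ ≥ 1/10`; instances: `not_isSiegelZero_of_noRealZeroUpTo` (any wide table),
  `not_isSiegelZero_upTo_1e9` (leaf `NoRealZeroUpTo_1e9`, certified two-lineage numerics of the
  cell), `not_isSiegelZero_upTo_1e10` (`luZamanZhao2026_theorem11`, width `1/5 > 1/10`);
  consequently the witnesses of `UnboundedSiegelZeros` all have conductor `> 10⁹` (resp. `> 10¹⁰`)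
  (`UnboundedSiegelZeros.exists_witness_above`).
* `norm_LFunction_one_ge_of_luZamanZhao13` / `eta_ge_one_eighth_upTo_1e10` — under
  Lu–Zaman–Zhao's Corollary 1.3 (`L(1,χ) ≥ 1/(8 log q)` for primitive quadratic `χ` mod
  `q ≤ 10¹⁰`), Friedlander–Iwaniec's `η(D) = L(1,χ) log D ≥ 1/8` for every conductor `3 ≤ D ≤ 10¹⁰`,
  and `not_strength_witness_upTo_1e10`: `‖L(1,χ)‖ ≤ (log q)^{−A}` fails at every conductor
  `q ≤ 10¹⁰` with `(log q)^{A−1} > 8` — the strength-`A` hypothesis has no witness in the table's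
  range beyond the trivially small conductors.

WHAT THIS IS NOT: no table refutes `UnboundedSiegelZeros`, `ExceptionalCharactersOfStrength A` or
any "infinitely many" hypothesis — those quantify over arbitrarily large conductors; a finite
certified range only pushes their witnesses beyond `Q`. Nothing here bears on the truth of any
illusory-world antecedent.

References: the cell's criteria [cite: Platt2016GRH] [cite: LuZamanZhao2026, Theorem 1.1 and
Corollary 1.3]; the antecedents [cite: TaoTeravainen2021, Definition 1.4]
[cite: Merikoski2024ExceptionalCharacters, §1 (1.1)].
-/

noncomputable section

namespace Literature.NumberTheory.LFunctions

open Literature.Barriers.Parity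

/-! ### An elementary inequality -/

/-- For `q ≥ 3`, `1 < log q`. [folklore] -/
private theorem one_lt_log_of_three_le {q : ℕ} (hq : 3 ≤ q) : 1 < Real.log q := by
  have hq3 : (3 : ℝ) ≤ (q : ℝ) := by exact_mod_cast hq
  have hlog3 : 1 < Real.log 3 := by
    have h := Real.exp_one_lt_d9
    rw [Real.lt_log_iff_exp_lt (by norm_num)]
    linarith
  exact lt_of_lt_of_le hlog3 (Real.log_le_log (by norm_num) hq3)

/-! ### Siegel zeros (Tao–Teräväinen quality) on a narrow table -/

/-- **On a narrow table the quality is bounded: `η < 1/c₀`.** Under `NoExceptionalZeroUpTo Q c₀`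
with `c₀ > 0`, a Siegel zero of quality `η` (Tao–Teräväinen, Definition 1.4: `χ` primitive
quadratic, `η ≥ 10`, `L(1 − 1/(η log q), χ) = 0`) attached to a conductor `3 ≤ q ≤ Q` has
`η < 1/c₀`: otherwise `σ = 1 − 1/(η log q)` lies in the window `[1 − c₀/log q, 1] ∩ (0, 1]`
(`η log q > 1` as `η ≥ 10`, `log q > 1`), where the table forbids a zero.
[cite: TaoTeravainen2021, Definition 1.4] -/
theorem _root_.Literature.Barriers.Parity.IsSiegelZero.quality_lt_inv_of_noExceptionalZeroUpTo
    {Q : ℕ} {c₀ : ℝ}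
    (h : NoExceptionalZeroUpTo Q c₀) (hc : 0 < c₀) {q : ℕ} [NeZero q] (hq3 : 3 ≤ q) (hqQ : q ≤ Q)
    {χ : DirichletCharacter ℂ q} {η : ℝ} (hS : IsSiegelZero χ η) : η < 1 / c₀ := by
  obtain ⟨hprim, hquad, hη10, hL⟩ := hS
  by_contra hge
  rw [not_lt] at hge
  have hlogq : 1 < Real.log q := one_lt_log_of_three_le hq3
  have hη0 : 0 < η := by linarith
  have hηlog : 1 < η * Real.log q := by nlinarith
  have hσ0 : 0 < 1 - 1 / (η * Real.log q) := by
    have : 1 / (η * Real.log q) < 1 := by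
      rw [div_lt_one (by positivity)]
      exact hηlog
    linarith
  have hσ1 : 1 - 1 / (η * Real.log q) ≤ 1 := by
    have : 0 ≤ 1 / (η * Real.log q) := by positivity
    linarith
  have hwin : 1 - c₀ / Real.log q ≤ 1 - 1 / (η * Real.log q) := by
    -- `1/(η log q) ≤ c₀/log q` since `1/η ≤ c₀`
    have h1 : 1 ≤ c₀ * η := by
      have := (div_le_iff₀ hc).1 hge
      linarith [mul_comm η c₀]
    have h2 : 1 / (η * Real.log q) ≤ c₀ / Real.log q := by
      rw [div_le_div_iff₀ (by positivity) (by linarith)]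
      have hlog0 : 0 < Real.log q := by linarith
      have := mul_le_mul_of_nonneg_right h1 hlog0.le
      nlinarith
    linarith
  exact h q hq3 hqQ χ hquad hprim _ hσ0 hwin hσ1 hL

/-- **No Siegel zero of any quality at the conductors of a narrow table of width `c₀ ≥ 1/10`.**
(Quality `≥ 10` by definition, `< 1/c₀ ≤ 10` by the table.) [cite: TaoTeravainen2021, Definition 1.4] -/
theorem not_isSiegelZero_of_noExceptionalZeroUpTo {Q : ℕ} {c₀ : ℝ} (h : NoExceptionalZeroUpTo Q c₀)
    (hc : 1 / 10 ≤ c₀) {q : ℕ} [NeZero q] (hq3 : 3 ≤ q) (hqQ : q ≤ Q) (χ : DirichletCharacter ℂ q)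
    (η : ℝ) : ¬ IsSiegelZero χ η := by
  intro hS
  have hc0 : 0 < c₀ := lt_of_lt_of_le (by norm_num) hc
  have h1 := hS.quality_lt_inv_of_noExceptionalZeroUpTo h hc0 hq3 hqQ
  have h2 : 1 / c₀ ≤ 10 := by
    rw [div_le_iff₀ hc0]
    have := (div_le_iff₀ (by norm_num : (0 : ℝ) < 10)).1 hc
    linarith
  linarith [hS.ten_le]

/-- **No Siegel zero of any quality at the conductors of a wide table** (`W ⇒ N` at every width).
[cite: TaoTeravainen2021, Definition 1.4] -/
theorem not_isSiegelZero_of_noRealZeroUpTo {Q : ℕ} (h : NoRealZeroUpTo Q) {q : ℕ} [NeZero q]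
    (hq3 : 3 ≤ q) (hqQ : q ≤ Q) (χ : DirichletCharacter ℂ q) (η : ℝ) : ¬ IsSiegelZero χ η :=
  not_isSiegelZero_of_noExceptionalZeroUpTo (h.noExceptionalZeroUpTo (1 / 10)) le_rfl hq3 hqQ χ η

/-- **Instance `Q = 10⁹` (rung leaf `NoRealZeroUpTo_1e9`, certified two-lineage numerics of the
cell `parity-realchar`):** no primitive quadratic character of conductor `3 ≤ q ≤ 10⁹` carries a
Siegel zero of any quality `η ≥ 10`. [cite: TaoTeravainen2021, Definition 1.4] -/
theorem not_isSiegelZero_upTo_1e9 (h : NoRealZeroUpTo_1e9) {q : ℕ} [NeZero q] (hq3 : 3 ≤ q)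
    (hqQ : q ≤ 1000000000) (χ : DirichletCharacter ℂ q) (η : ℝ) : ¬ IsSiegelZero χ η :=
  not_isSiegelZero_of_noRealZeroUpTo h hq3 hqQ χ η

/-- **Instance `Q = 10¹⁰` (Lu–Zaman–Zhao, Theorem 1.1, single-lineage print):** no primitive
quadratic character of conductor `3 ≤ q ≤ 10¹⁰` carries a Siegel zero of any quality `η ≥ 10`
(the narrow width `1/5` bounds the quality by `5 < 10`). [cite: LuZamanZhao2026, Theorem 1.1] -/
theorem not_isSiegelZero_upTo_1e10 (h11 : luZamanZhao2026_theorem11) {q : ℕ} [NeZero q]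
    (hq3 : 3 ≤ q) (hqQ : q ≤ 10 ^ 10) (χ : DirichletCharacter ℂ q) (η : ℝ) : ¬ IsSiegelZero χ η :=
  not_isSiegelZero_of_noExceptionalZeroUpTo (noExceptionalZeroUpTo_of_luZamanZhao h11)
    (by norm_num) hq3 hqQ χ η

/-- **The witnesses of `UnboundedSiegelZeros` lie above any wide table.** If Siegel zeros of
unbounded quality exist and `NoRealZeroUpTo Q` holds, then for every `η₀` there is a Siegel zero
of quality `≥ η₀` attached to a conductor `q > Q` (the hypothesis' witness at threshold
`max q₀ (Q + 1)`; conductors `≤ 2` carry no primitive quadratic character with `η log q > 1`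
issues since the table's floor is `3`, so we simply ask for `q ≥ Q + 1` and `q ≥ 3`).
[cite: TaoTeravainen2021, Definition 1.4 and Theorem 1.5] -/
theorem _root_.Literature.Barriers.Parity.UnboundedSiegelZeros.exists_witness_above
    (hU : Summit.Parity.GeneralizedHardyLittlewood.UnboundedSiegelZeros) (Q : ℕ) (η₀ : ℝ) :
    ∃ (q : ℕ) (_ : NeZero q) (χ : DirichletCharacter ℂ q) (η : ℝ),
      Q < q ∧ η₀ ≤ η ∧ IsSiegelZero χ η := by
  obtain ⟨q, hq, χ, η, hqQ, hη, hS⟩ := hU η₀ (Q + 1)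
  exact ⟨q, hq, χ, η, by omega, hη, hS⟩

/-- Under a wide table to `Q`, the open hypothesis `UnboundedSiegelZeros` is EQUIVALENT to its
restriction to conductors `> Q` — the table removes exactly the small-conductor witnesses and
says nothing beyond. [cite: TaoTeravainen2021, Definition 1.4] -/
theorem unboundedSiegelZeros_iff_above_of_noRealZeroUpTo {Q : ℕ} (_h : NoRealZeroUpTo Q) :
    Summit.Parity.GeneralizedHardyLittlewood.UnboundedSiegelZeros ↔
      ∀ (η₀ : ℝ) (q₀ : ℕ), ∃ (q : ℕ) (_ : NeZero q) (χ : DirichletCharacter ℂ q) (η : ℝ),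
        Q < q ∧ q₀ ≤ q ∧ η₀ ≤ η ∧ IsSiegelZero χ η := by
  constructor
  · intro hU η₀ q₀
    obtain ⟨q, hq, χ, η, hqQ, hη, hS⟩ := hU η₀ (max q₀ (Q + 1))
    exact ⟨q, hq, χ, η, by omega, by omega, hη, hS⟩
  · intro h η₀ q₀
    obtain ⟨q, hq, χ, η, _, hq₀, hη, hS⟩ := h η₀ q₀
    exact ⟨q, hq, χ, η, hq₀, hη, hS⟩

/-! ### Exceptional characters (Merikoski strength, Friedlander–Iwaniec `η(D)`) below `10¹⁰` -/

/-- **`η(D) = L(1,χ) log D ≥ 1/8` for every primitive quadratic `χ` of conductor `3 ≤ D ≤ 10¹⁰`**,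
under Lu–Zaman–Zhao's Corollary 1.3 (`L(1,χ) ≥ 1/(8 log q)`; `‖L(1,χ)‖ ≥ Re L(1,χ)`).
[cite: LuZamanZhao2026, Corollary 1.3] -/
theorem eta_ge_one_eighth_upTo_1e10 (h13 : luZamanZhao2026_corollary13) {q : ℕ} [NeZero q]
    (hq3 : 3 ≤ q) (hqQ : q ≤ 10 ^ 10) (χ : DirichletCharacter ℂ q) (hprim : χ.IsPrimitive)
    (hquad : χ.IsQuadratic) : 1 / 8 ≤ ‖χ.LFunction 1‖ * Real.log q := by
  have hne : χ ≠ 1 := SiegelZeroQuality.ne_one_of_isPrimitive hprim (by omega)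
  have hlogq : 1 < Real.log q := one_lt_log_of_three_le hq3
  have h1 := h13 q hqQ χ hquad hne hprim
  have h2 : (χ.LFunction 1).re ≤ ‖χ.LFunction 1‖ := Complex.re_le_norm _
  have h3 : 1 / (8 * Real.log q) * Real.log q = 1 / 8 := by
    field_simp
  calc (1 : ℝ) / 8 = 1 / (8 * Real.log q) * Real.log q := h3.symm
    _ ≤ ‖χ.LFunction 1‖ * Real.log q :=
        mul_le_mul_of_nonneg_right (h1.trans h2) (by linarith)

/-- **`‖L(1,χ)‖ ≥ 1/(8 log q)` for primitive quadratic `χ` mod `3 ≤ q ≤ 10¹⁰`** (Lu–Zaman–Zhao,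
Corollary 1.3, norm form). [cite: LuZamanZhao2026, Corollary 1.3] -/
theorem norm_LFunction_one_ge_of_luZamanZhao13 (h13 : luZamanZhao2026_corollary13) {q : ℕ}
    [NeZero q] (hq3 : 3 ≤ q) (hqQ : q ≤ 10 ^ 10) (χ : DirichletCharacter ℂ q)
    (hprim : χ.IsPrimitive) (hquad : χ.IsQuadratic) : 1 / (8 * Real.log q) ≤ ‖χ.LFunction 1‖ := by
  have hne : χ ≠ 1 := SiegelZeroQuality.ne_one_of_isPrimitive hprim (by omega)
  exact (h13 q hqQ χ hquad hne hprim).trans (Complex.re_le_norm _)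

/-- **No strength-`A` witness below `10¹⁰`.** Under Lu–Zaman–Zhao's Corollary 1.3: if
`3 ≤ q ≤ 10¹⁰` and `(log q)^{A−1} > 8`, then no primitive quadratic `χ` mod `q` has
`‖L(1,χ)‖ ≤ (log q)^{−A}` (as `(log q)^{−A} = 1/((log q)^{A−1} log q) < 1/(8 log q)`). For
Merikoski's exponent `A = 100` the side condition holds from `q = 3` on; for `A = 3` from `q = 17`.
[cite: Merikoski2024ExceptionalCharacters, §1 (1.1)] [cite: LuZamanZhao2026, Corollary 1.3] -/
theorem not_strength_witness_upTo_1e10 (h13 : luZamanZhao2026_corollary13) {q : ℕ} [NeZero q]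
    (hq3 : 3 ≤ q) (hqQ : q ≤ 10 ^ 10) {A : ℝ} (hA : 8 < Real.log q ^ (A - 1))
    (χ : DirichletCharacter ℂ q) (hprim : χ.IsPrimitive) (hquad : χ.IsQuadratic) :
    ¬ ‖χ.LFunction 1‖ ≤ Real.log q ^ (-A) := by
  intro hle
  have hlogq : 1 < Real.log q := one_lt_log_of_three_le hq3
  have hlog0 : 0 < Real.log q := by linarith
  have h1 := norm_LFunction_one_ge_of_luZamanZhao13 h13 hq3 hqQ χ hprim hquad
  -- `(log q)^{-A} = 1 / ((log q)^{A-1} * log q)`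
  have hrw : Real.log q ^ (-A) = 1 / (Real.log q ^ (A - 1) * Real.log q) := by
    rw [show -A = -((A - 1) + 1) by ring, Real.rpow_neg hlog0.le, Real.rpow_add_one hlog0.ne',
      one_div]
  rw [hrw] at hle
  have hpow0 : 0 < Real.log q ^ (A - 1) := Real.rpow_pos_of_pos hlog0 _
  have h2 : 1 / (Real.log q ^ (A - 1) * Real.log q) < 1 / (8 * Real.log q) := by
    apply one_div_lt_one_div_of_lt (by positivity)
    exact mul_lt_mul_of_pos_right hA hlog0
  linarith

/-- **The witnesses of `ExceptionalCharactersOfStrength A` lie above `10¹⁰`** (for conductors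
where `(log q)^{A−1} > 8`): under Lu–Zaman–Zhao's Corollary 1.3, every witness `(q, χ)` of
strength `A` with `(log q)^{A−1} > 8` has `q > 10¹⁰`.
[cite: Merikoski2024ExceptionalCharacters, §1 (1.1)] [cite: LuZamanZhao2026, Corollary 1.3] -/
theorem strength_witness_above_1e10 (h13 : luZamanZhao2026_corollary13) {A : ℝ} {q : ℕ} [NeZero q]
    (hq3 : 3 ≤ q) (hA : 8 < Real.log q ^ (A - 1)) (χ : DirichletCharacter ℂ q)
    (hprim : χ.IsPrimitive) (hquad : χ.IsQuadratic) (hL : ‖χ.LFunction 1‖ ≤ Real.log q ^ (-A)) :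
    10 ^ 10 < q := by
  by_contra hle
  rw [not_lt] at hle
  exact not_strength_witness_upTo_1e10 h13 hq3 hle hA χ hprim hquad hL

/-! ### Friedlander–Iwaniec's hypotheses below `10¹⁰` (appended 2026-08-26)

With `ExceptionalCharacterPrimesInProgressions.lean` (`FI2003Exceptional D χ`: Iwaniec 2006 (9.3),
`L(1,χ) ≤ (log D)^{−1−r^r}`, `r = 554 401`) and `ExceptionalCharacterTwinPrimes.lean`
(`SmallEtaCharacters ε`: Friedlander–Iwaniec's `η(D) = L(1,χ) log D ≤ ε` at arbitrarily large
conductors) landed, the same Lu–Zaman–Zhao bound `L(1,χ) ≥ 1/(8 log D)` (`q ≤ 10¹⁰`) excludes their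
witnesses of conductor `≤ 10¹⁰`: (9.3) fails for EVERY `3 ≤ D ≤ 10¹⁰` (no side condition, because
`(log D)^{r^r} > 8` already at `D = 3`), and `η(D) ≥ 1/8` there. As before: this pushes witnesses
beyond `10¹⁰`; it refutes no "infinitely many" hypothesis. -/

/-- `log 3 ≥ 1 + 1/40` (from `log 2 > 0.6931` and `log(3/2) ≥ 1 − 2/3`). [folklore] -/
private theorem log_three_ge : (1 : ℝ) + 1 / 40 ≤ Real.log 3 := by
  have h2 := Real.log_two_gt_d9
  have h32 : (1 : ℝ) - (3 / 2 : ℝ)⁻¹ ≤ Real.log (3 / 2) :=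
    Real.one_sub_inv_le_log_of_pos (by norm_num)
  have hmul : Real.log 3 = Real.log 2 + Real.log (3 / 2) := by
    rw [← Real.log_mul (by norm_num) (by norm_num)]
    norm_num
  rw [hmul]
  norm_num at h32 ⊢
  linarith

/-- **`(log D)^{r^r} > 8` for every `D ≥ 3`** (`r = 554 401`): the exponent in (9.2)–(9.3) is so
large that the logarithmic factor exceeds any fixed constant from the first admissible conductor on
(`log D ≥ log 3 ≥ 1 + 1/40` and Bernoulli: `(1 + 1/40)^N ≥ 1 + N/40` with `N = r^r ≥ r > 280`).
[cite: IwaniecConversations2006, §9.1 (9.2)] -/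
theorem FI2003.eight_lt_log_rpow {D : ℕ} (hD : 3 ≤ D) :
    (8 : ℝ) < Real.log D ^ ((FI2003.r : ℝ) ^ FI2003.r) := by
  have hD3 : (3 : ℝ) ≤ D := by exact_mod_cast hD
  have hlog3 : 1 + 1 / 40 ≤ Real.log D :=
    log_three_ge.trans (Real.log_le_log (by norm_num) hD3)
  -- rewrite the real exponent as a natural power `N = r^r`
  set N : ℕ := FI2003.r ^ FI2003.r with hNdef
  have hcast : ((FI2003.r : ℝ) ^ FI2003.r) = (N : ℝ) := by rw [hNdef, Nat.cast_pow]
  rw [hcast, Real.rpow_natCast]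
  -- `N ≥ r ≥ 281`
  have hr1 : 1 ≤ FI2003.r := by unfold FI2003.r; norm_num
  have hN : FI2003.r ≤ N := by
    calc FI2003.r = FI2003.r ^ 1 := (pow_one _).symm
      _ ≤ FI2003.r ^ FI2003.r := Nat.pow_le_pow_right hr1 hr1
  have hr : (281 : ℝ) ≤ (FI2003.r : ℝ) := by unfold FI2003.r; norm_num
  have hNr : (281 : ℝ) ≤ (N : ℝ) := hr.trans (by exact_mod_cast hN)
  -- Bernoulli
  have hB : 1 + (N : ℝ) * (1 / 40) ≤ (1 + 1 / 40 : ℝ) ^ N := one_add_mul_le_pow (by norm_num) _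
  have hmono : (1 + 1 / 40 : ℝ) ^ N ≤ Real.log D ^ N := pow_le_pow_left₀ (by norm_num) hlog3 _
  linarith

/-- **Friedlander–Iwaniec's exceptionality (9.3) has no witness of conductor `≤ 10¹⁰`** (under
Lu–Zaman–Zhao's Corollary 1.3): for `3 ≤ D ≤ 10¹⁰` and `χ` primitive quadratic mod `D`,
`¬ (L(1,χ) ≤ (log D)^{−1−r^r})` — since `L(1,χ) ≥ 1/(8 log D)` while
`(log D)^{−1−r^r} = 1/((log D)^{r^r} log D) < 1/(8 log D)`. So the Linnik-exponent theorem
`FriedlanderIwaniec2003_linnik` has an empty antecedent for every `D ≤ 10¹⁰`: its moduli range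
starts above `q ≥ D^r > 10^{5 544 010}`. [cite: IwaniecConversations2006, §9.1 (9.3)]
[cite: LuZamanZhao2026, Corollary 1.3] -/
theorem not_fi2003Exceptional_upTo_1e10 (h13 : luZamanZhao2026_corollary13) {D : ℕ} [NeZero D]
    (hD3 : 3 ≤ D) (hDQ : D ≤ 10 ^ 10) (χ : DirichletCharacter ℂ D) (hprim : χ.IsPrimitive)
    (hquad : χ.IsQuadratic) : ¬ FI2003Exceptional D χ := by
  intro hexc
  rw [fi2003Exceptional_iff] at hexc
  have hlogq : 1 < Real.log D := one_lt_log_of_three_le hD3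
  have hlog0 : 0 < Real.log D := by linarith
  have h1 := norm_LFunction_one_ge_of_luZamanZhao13 h13 hD3 hDQ χ hprim hquad
  have h8 := FI2003.eight_lt_log_rpow hD3
  have hrw : Real.log D ^ (-(1 + (FI2003.r : ℝ) ^ FI2003.r)) =
      1 / (Real.log D ^ ((FI2003.r : ℝ) ^ FI2003.r) * Real.log D) := by
    rw [show -(1 + (FI2003.r : ℝ) ^ FI2003.r) = -(((FI2003.r : ℝ) ^ FI2003.r) + 1) by ring,
      Real.rpow_neg hlog0.le, Real.rpow_add_one hlog0.ne', one_div]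
  rw [hrw] at hexc
  have hpow0 : 0 < Real.log D ^ ((FI2003.r : ℝ) ^ FI2003.r) := Real.rpow_pos_of_pos hlog0 _
  have h2 : 1 / (Real.log D ^ ((FI2003.r : ℝ) ^ FI2003.r) * Real.log D) < 1 / (8 * Real.log D) := by
    apply one_div_lt_one_div_of_lt (by positivity)
    exact mul_lt_mul_of_pos_right h8 hlog0
  linarith

/-- **Friedlander–Iwaniec's `η(D) ≤ ε` has no witness of conductor `≤ 10¹⁰` for `ε < 1/8`** (under
Lu–Zaman–Zhao's Corollary 1.3): every witness `(D, χ)` of `SmallEtaCharacters ε` has `D > 10¹⁰`.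
[cite: FriedlanderIwaniec2019TwinPrimes, (1.6)] [cite: LuZamanZhao2026, Corollary 1.3] -/
theorem smallEta_witness_above_1e10 (h13 : luZamanZhao2026_corollary13) {ε : ℝ} (hε : ε < 1 / 8)
    {D : ℕ} [NeZero D] (hD3 : 3 ≤ D) (χ : DirichletCharacter ℂ D) (hprim : χ.IsPrimitive)
    (hquad : χ.IsQuadratic) (hη : ‖χ.LFunction 1‖ * Real.log D ≤ ε) : 10 ^ 10 < D := by
  by_contra hle
  rw [not_lt] at hle
  have := eta_ge_one_eighth_upTo_1e10 h13 hD3 hle χ hprim hquad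
  linarith

/-- Hence, under Lu–Zaman–Zhao's Corollary 1.3, `SmallEtaCharacters ε` for `ε < 1/8` is equivalent
to its restriction to conductors `> 10¹⁰`. [cite: FriedlanderIwaniec2019TwinPrimes, (1.6)]
[cite: LuZamanZhao2026, Corollary 1.3] -/
theorem smallEtaCharacters_iff_above_1e10 (h13 : luZamanZhao2026_corollary13) {ε : ℝ}
    (hε : ε < 1 / 8) :
    SmallEtaCharacters ε ↔
      ∀ q₀ : ℕ, ∃ (D : ℕ) (_ : NeZero D) (χ : DirichletCharacter ℂ D),
        10 ^ 10 < D ∧ q₀ ≤ D ∧ 3 ≤ D ∧ χ.IsPrimitive ∧ χ.IsQuadratic ∧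
          ‖χ.LFunction 1‖ * Real.log D ≤ ε := by
  constructor
  · intro h q₀
    obtain ⟨D, hDne, χ, hq₀, hD3, hprim, hquad, hη⟩ := h q₀
    exact ⟨D, hDne, χ, smallEta_witness_above_1e10 h13 hε hD3 χ hprim hquad hη, hq₀, hD3, hprim,
      hquad, hη⟩
  · intro h q₀
    obtain ⟨D, hDne, χ, _, hq₀, hD3, hprim, hquad, hη⟩ := h q₀
    exact ⟨D, hDne, χ, hq₀, hD3, hprim, hquad, hη⟩

/-! ### The decade `10¹⁰` re-based on the cell's leaves (appended 2026-08-26)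

The `10¹⁰` ZERO statements of this file re-based on the value-free leaves `NoRealZeroOddUpTo_1e10`
(odd cells, book first) and `NoRealZeroUpTo_1e10` of `RealCharacterLadderLeaves.lean` (SWEEP-BOARD
R-8: the cell's two-lineage certified numerics) in addition to the PRINT versions above
(`luZamanZhao2026_theorem11`). The `L(1,χ)`-floor statements (`eta_ge_one_eighth_upTo_1e10`,
`not_strength_witness_upTo_1e10`, `not_fi2003Exceptional_upTo_1e10`,
`smallEtaCharacters_iff_above_1e10`) rest on Lu–Zaman–Zhao's Corollary 1.3, a LOWER BOUND for
`L(1,χ)` that no zero-free leaf implies by itself; they stay print-based. -/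

/-- **No Siegel zero for ODD characters on an odd wide table** (any `Q`): under
`NoRealZeroOddUpTo Q`, no primitive quadratic odd `χ` of conductor `3 ≤ q ≤ Q` carries a Siegel zero
of any quality `η ≥ 10` (`σ = 1 − 1/(η log q) ∈ (0, 1)` since `η log q > 1`).
[cite: TaoTeravainen2021, Definition 1.4] -/
theorem not_isSiegelZero_of_noRealZeroOddUpTo {Q : ℕ} (h : NoRealZeroOddUpTo Q) {q : ℕ} [NeZero q]
    (hq3 : 3 ≤ q) (hqQ : q ≤ Q) (χ : DirichletCharacter ℂ q) (hodd : χ.Odd) (η : ℝ) :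
    ¬ IsSiegelZero χ η := by
  rintro ⟨hprim, hquad, hη10, hL⟩
  have hlogq : 1 < Real.log q := one_lt_log_of_three_le hq3
  have hηlog : 1 < η * Real.log q := by nlinarith
  have hpos : 0 < 1 / (η * Real.log q) := by positivity
  have hσ0 : 0 < 1 - 1 / (η * Real.log q) := by
    have : 1 / (η * Real.log q) < 1 := by rwa [div_lt_one (by positivity)]
    linarith
  exact h q hq3 hqQ χ hquad hprim hodd _ hσ0 (by linarith) hL

/-- On an odd wide table every Siegel zero at a conductor `3 ≤ q ≤ Q` belongs to an EVEN character
(with `NoRealZeroOddUpTo_1e10`: at every `q ≤ 10¹⁰`). [cite: TaoTeravainen2021, Definition 1.4] -/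
theorem _root_.Literature.Barriers.Parity.IsSiegelZero.even_of_noRealZeroOddUpTo {Q : ℕ}
    (h : NoRealZeroOddUpTo Q) {q : ℕ} [NeZero q] (hq3 : 3 ≤ q) (hqQ : q ≤ Q)
    {χ : DirichletCharacter ℂ q} {η : ℝ} (hS : IsSiegelZero χ η) : χ.Even := by
  rcases χ.even_or_odd with heven | hodd
  · exact heven
  · exact absurd hS (not_isSiegelZero_of_noRealZeroOddUpTo h hq3 hqQ χ hodd η)

/-- **Instance `Q = 10¹⁰`, ODD characters (leaf `NoRealZeroOddUpTo_1e10`: SWEEP-BOARD odd cells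
s1–s10, certified numerics of the cell, value-free until booked):** no primitive quadratic odd
character of conductor `3 ≤ q ≤ 10¹⁰` carries a Siegel zero of any quality — `33×` Watkins' printed
odd range `3·10⁸`. [cite: TaoTeravainen2021, Definition 1.4] -/
theorem not_isSiegelZero_odd_upTo_1e10 (h : NoRealZeroOddUpTo_1e10) {q : ℕ} [NeZero q]
    (hq3 : 3 ≤ q) (hqQ : q ≤ 10 ^ 10) (χ : DirichletCharacter ℂ q) (hodd : χ.Odd) (η : ℝ) :
    ¬ IsSiegelZero χ η :=
  not_isSiegelZero_of_noRealZeroOddUpTo h hq3 (by norm_num at hqQ ⊢; exact hqQ) χ hodd η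

/-- **Instance `Q = 10¹⁰`, both parities, CERTIFIED-NUMERICS version (leaf `NoRealZeroUpTo_1e10`,
value-free until the decade books in both parities)** — the same conclusion as
`not_isSiegelZero_upTo_1e10` (which rests on the PRINT fact `luZamanZhao2026_theorem11`): no
primitive quadratic character of conductor `3 ≤ q ≤ 10¹⁰` carries a Siegel zero of any quality.
[cite: TaoTeravainen2021, Definition 1.4] -/
theorem not_isSiegelZero_upTo_1e10_of_leaf (h : NoRealZeroUpTo_1e10) {q : ℕ} [NeZero q]
    (hq3 : 3 ≤ q) (hqQ : q ≤ 10 ^ 10) (χ : DirichletCharacter ℂ q) (η : ℝ) : ¬ IsSiegelZero χ η :=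
  not_isSiegelZero_of_noRealZeroUpTo h hq3 (by norm_num at hqQ ⊢; exact hqQ) χ η

/-- Under the leaf `NoRealZeroUpTo_1e10`, the open hypothesis `UnboundedSiegelZeros` is equivalent to
its restriction to conductors `> 10¹⁰` (instance of `unboundedSiegelZeros_iff_above_of_noRealZeroUpTo`;
tail-only reading, S2). [cite: TaoTeravainen2021, Definition 1.4] -/
theorem unboundedSiegelZeros_iff_above_1e10_of_leaf (h : NoRealZeroUpTo_1e10) :
    Summit.Parity.GeneralizedHardyLittlewood.UnboundedSiegelZeros ↔
      ∀ (η₀ : ℝ) (q₀ : ℕ), ∃ (q : ℕ) (_ : NeZero q) (χ : DirichletCharacter ℂ q) (η : ℝ),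
        10000000000 < q ∧ q₀ ≤ q ∧ η₀ ≤ η ∧ IsSiegelZero χ η :=
  unboundedSiegelZeros_iff_above_of_noRealZeroUpTo h

/-! ### Appendix D3 (rc-cond g3): the odd rung leaf `NoRealZeroOddUpTo_3e10` (route
`RealCharacterOddThirtyBillion`'s closes-target, conductors `(10¹⁰, 3·10¹⁰]`; certified numerics of
the cell, VALUE-FREE until the rung books) -/

/-- **Instance `Q = 3·10¹⁰`, ODD characters (leaf `NoRealZeroOddUpTo_3e10`):** no primitive quadratic
odd character of conductor `3 ≤ q ≤ 3·10¹⁰` carries a Siegel zero of any quality — `100×` Watkins'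
printed odd range `3·10⁸`. [cite: TaoTeravainen2021, Definition 1.4] -/
theorem not_isSiegelZero_odd_upTo_3e10 (h : NoRealZeroOddUpTo_3e10) {q : ℕ} [NeZero q]
    (hq3 : 3 ≤ q) (hqQ : q ≤ 3 * 10 ^ 10) (χ : DirichletCharacter ℂ q) (hodd : χ.Odd) (η : ℝ) :
    ¬ IsSiegelZero χ η :=
  not_isSiegelZero_of_noRealZeroOddUpTo h hq3 (by norm_num at hqQ ⊢; exact hqQ) χ hodd η

/-- Under the odd rung leaf, every Siegel zero at a conductor `3 ≤ q ≤ 3·10¹⁰` belongs to an EVEN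
character (tail-only reading: odd witnesses of `UnboundedSiegelZeros` have conductor `> 3·10¹⁰`).
[cite: TaoTeravainen2021, Definition 1.4] -/
theorem _root_.Literature.Barriers.Parity.IsSiegelZero.even_of_noRealZeroOddUpTo_3e10
    (h : NoRealZeroOddUpTo_3e10) {q : ℕ} [NeZero q] (hq3 : 3 ≤ q) (hqQ : q ≤ 3 * 10 ^ 10)
    {χ : DirichletCharacter ℂ q} {η : ℝ} (hS : IsSiegelZero χ η) : χ.Even :=
  hS.even_of_noRealZeroOddUpTo h hq3 (by norm_num at hqQ ⊢; exact hqQ)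


/-! ### Appendix D4 (rc-cond g5, 2026-08-26): the EVEN rung leaf `NoRealZeroEvenUpTo_3e10` (route G's
would-be closes-target) and the WIDE rung leaf `NoRealZeroUpTo_3e10` (= odd ∧ even,
`noRealZeroUpTo_3e10_iff_odd_and_even`) — PRE-REGISTERED readings, certified numerics of the cell,
VALUE-FREE until the rungs book in both parities; nothing here asserts a leaf. -/

/-- **No Siegel zero for EVEN characters on an even wide table** (any `Q`): under
`NoRealZeroEvenUpTo Q`, no primitive quadratic even `χ` of conductor `3 ≤ q ≤ Q` carries a Siegel zero
of any quality `η ≥ 10` (the even twin of `not_isSiegelZero_of_noRealZeroOddUpTo`).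
[cite: TaoTeravainen2021, Definition 1.4] -/
theorem not_isSiegelZero_of_noRealZeroEvenUpTo {Q : ℕ} (h : NoRealZeroEvenUpTo Q) {q : ℕ} [NeZero q]
    (hq3 : 3 ≤ q) (hqQ : q ≤ Q) (χ : DirichletCharacter ℂ q) (heven : χ.Even) (η : ℝ) :
    ¬ IsSiegelZero χ η := by
  rintro ⟨hprim, hquad, hη10, hL⟩
  have hlogq : 1 < Real.log q := one_lt_log_of_three_le hq3
  have hηlog : 1 < η * Real.log q := by nlinarith
  have hpos : 0 < 1 / (η * Real.log q) := by positivity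
  have hσ0 : 0 < 1 - 1 / (η * Real.log q) := by
    have : 1 / (η * Real.log q) < 1 := by rwa [div_lt_one (by positivity)]
    linarith
  exact h q hq3 hqQ χ hquad hprim heven _ hσ0 (by linarith) hL

/-- On an even wide table every Siegel zero at a conductor `3 ≤ q ≤ Q` belongs to an ODD character.
[cite: TaoTeravainen2021, Definition 1.4] -/
theorem _root_.Literature.Barriers.Parity.IsSiegelZero.odd_of_noRealZeroEvenUpTo {Q : ℕ}
    (h : NoRealZeroEvenUpTo Q) {q : ℕ} [NeZero q] (hq3 : 3 ≤ q) (hqQ : q ≤ Q)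
    {χ : DirichletCharacter ℂ q} {η : ℝ} (hS : IsSiegelZero χ η) : χ.Odd := by
  rcases χ.even_or_odd with heven | hodd
  · exact absurd hS (not_isSiegelZero_of_noRealZeroEvenUpTo h hq3 hqQ χ heven η)
  · exact hodd

/-- **Instance `Q = 3·10¹⁰`, EVEN characters (leaf `NoRealZeroEvenUpTo_3e10`):** no primitive quadratic
even character of conductor `3 ≤ q ≤ 3·10¹⁰` carries a Siegel zero of any quality — `75 000×` Platt's
printed even range `4·10⁵` (the only even-specific exclusion in print, via GRH to height `10⁸/q`).
[cite: TaoTeravainen2021, Definition 1.4] [cite: Platt2016GRH, Theorems 7.1 and 7.2] -/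
theorem not_isSiegelZero_even_upTo_3e10 (h : NoRealZeroEvenUpTo_3e10) {q : ℕ} [NeZero q]
    (hq3 : 3 ≤ q) (hqQ : q ≤ 3 * 10 ^ 10) (χ : DirichletCharacter ℂ q) (heven : χ.Even) (η : ℝ) :
    ¬ IsSiegelZero χ η :=
  not_isSiegelZero_of_noRealZeroEvenUpTo h hq3 (by norm_num at hqQ ⊢; exact hqQ) χ heven η

/-- **Instance `Q = 3·10¹⁰`, both parities, from the two rung leaves** (`NoRealZeroOddUpTo_3e10` of
route F and `NoRealZeroEvenUpTo_3e10` of route G): no primitive quadratic character of conductor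
`3 ≤ q ≤ 3·10¹⁰` carries a Siegel zero of any quality. [cite: TaoTeravainen2021, Definition 1.4] -/
theorem not_isSiegelZero_upTo_3e10_of_odd_even (hodd : NoRealZeroOddUpTo_3e10)
    (heven : NoRealZeroEvenUpTo_3e10) {q : ℕ} [NeZero q] (hq3 : 3 ≤ q) (hqQ : q ≤ 3 * 10 ^ 10)
    (χ : DirichletCharacter ℂ q) (η : ℝ) : ¬ IsSiegelZero χ η := by
  rcases χ.even_or_odd with he | ho
  · exact not_isSiegelZero_even_upTo_3e10 heven hq3 hqQ χ he η
  · exact not_isSiegelZero_odd_upTo_3e10 hodd hq3 hqQ χ ho η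

/-- **Instance `Q = 3·10¹⁰`, both parities, on the WIDE rung leaf `NoRealZeroUpTo_3e10`:** no
primitive quadratic character of conductor `3 ≤ q ≤ 3·10¹⁰` carries a Siegel zero of any quality —
`3×` Lu–Zaman–Zhao's printed `10¹⁰` (there for `σ ≥ 1 − 1/(5 log q)` only, here the whole of
`(0, 1)`). [cite: TaoTeravainen2021, Definition 1.4] [cite: LuZamanZhao2026, Theorem 1.1] -/
theorem not_isSiegelZero_upTo_3e10_of_leaf (h : NoRealZeroUpTo_3e10) {q : ℕ} [NeZero q]
    (hq3 : 3 ≤ q) (hqQ : q ≤ 3 * 10 ^ 10) (χ : DirichletCharacter ℂ q) (η : ℝ) : ¬ IsSiegelZero χ η :=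
  not_isSiegelZero_of_noRealZeroUpTo h hq3 (by norm_num at hqQ ⊢; exact hqQ) χ η

/-- Under the wide rung leaf `NoRealZeroUpTo_3e10`, the open hypothesis `UnboundedSiegelZeros` is
equivalent to its restriction to conductors `> 3·10¹⁰` (tail-only reading, S2: the table relocates
the witnesses, it does not refute the hypothesis). [cite: TaoTeravainen2021, Definition 1.4] -/
theorem unboundedSiegelZeros_iff_above_3e10_of_leaf (h : NoRealZeroUpTo_3e10) :
    Summit.Parity.GeneralizedHardyLittlewood.UnboundedSiegelZeros ↔
      ∀ (η₀ : ℝ) (q₀ : ℕ), ∃ (q : ℕ) (_ : NeZero q) (χ : DirichletCharacter ℂ q) (η : ℝ),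
        30000000000 < q ∧ q₀ ≤ q ∧ η₀ ≤ η ∧ IsSiegelZero χ η :=
  unboundedSiegelZeros_iff_above_of_noRealZeroUpTo h

end Literature.NumberTheory.LFunctions

end
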